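import Mathlib
import Summits.ResolutionOfSingularities.ResolutionOfSingularities.Theorems.WeightedInvariantLocalWeightedDropWildMonicFlagDropAxisN0ChildMax
import Summits.ResolutionOfSingularities.ResolutionOfSingularities.Theorems.WeightedInvariantLocalWeightedDropWildMonicCleanRepS
import Summits.ResolutionOfSingularities.ResolutionOfSingularities.Theorems.WeightedInvariantLocalWeightedDropWildMonicFlagPos

/-!
# `WeightedInvariant.LocalWeightedDrop`, line `hasse-ridge-face-selection`, S3ρ flag line: Uk-ρD1 (f) — SETTING BOOKKEEPING for the
# assembly `axisPackageN0_holds` (valid flags against a clean representative; the kept corner; the `s = ⊤` re-cleaning)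

Crux item stmt-ResolutionOfSingularities-8899 `LocalWeightedDrop` (route `ResolutionOfSingularities/WeightedInvariant`), engine of the door
`HypersurfaceCentreConstruction` stmt-ResolutionOfSingularities-19897.  [OURS · L1 W4.3, chain w43, res-type-013 on res-L1-w43-plan-1 DEALS
gen 10 #2 (6) «Uk-ρD1 (f) `axisPackageN0_holds` ASSEMBLY» (in-flight item, RULING gen 9 #7 finish-in-flight), successor hand of res-D-pv-005 AS
res-L1-w43-stub-7 (parent pipeline p516193 … p522031) under res-type-083's CUT 2026-08-27T09:03Z.  MODEL: S. Perlega, arXiv:2011.14443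
Prop. 7.4.5 (clean hypersurfaces are valid / `d`-maximal / `s`-maximal), Prop. 9.1.1 and Lemma 9.1.2 (the induced `n = 0` flag of an axis step);
every object is OURS; nothing here is a statement of H. Hironaka's manuscript [claim: Hironaka2017, status: under-review].]

Small lemmas the assembly needs and the tree does not yet spell out:
* `excExp_eq_of_isMMax_of_isWClean`, `dRes_le_of_isMMax_of_isWClean` — at a representative `shift d A g₀` that is `(1,0)`/`(0,1)`-clean along the
  boundary (and `(1,1)`-clean), every VALID `n = 0`, `h = 0` flag `g` has the SAME exceptional exponents and `dRes ≤` (Prop. 7.4.5 (2) bookkeeping: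
  Prop. 5.1.3 bounds each `r_i` and `δ`, validity bounds `r₀ + r₁` from below);
* `dRes_pos_of_isWClean` — hence the clean representative has `d_𝓕 > 0` off the exits (Lemma 7.4.11 via res-L1-w43-stub-1's `exists_isMMax_dRes_pos`);
* `deltaL_image_psi_le_two_mul` — `δ(Ψ_L N) ≤ 2·δ(N)` (the size of the perturbed weight `ρ_M`);
* `exists_corner_of_kept` — if the residual order is KEPT by the monomial point step, the successor set contains the transported corner
  `P′ = (r′₀, δ′ − r′₀)` (Lemma 9.1.2: `in(I₂′) ∋ y^d`; stub-7's `eq_corner_of_deltaL_image_psi_eq` read back on the unreduced set);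
* `srcWeight_rhoWeight` — the source weight of `ρ_M = (M+1, M)` is `(M+1, 2M+1)`;
* `exists_shift_isWClean_list_of_upper_top`, `exists_isWClean_list_sTop_or_sMax` — the `s = ⊤` VARIANT of stub-7's re-cleaning inside a maximal
  setting class (`…WildMonicCleanRepS.exists_shift_isWClean_list_of_upper` quantified over every natural `s` at once), and the resulting
  dichotomy «a clean member with `sFlag = ⊤`, or a clean secondary-clean member with finite maximal `s`».
-/

set_option linter.dupNamespace false -- mandated namespace of this single-conjunct summit

noncomputable section

namespace Summit.ResolutionOfSingularities.ResolutionOfSingularities.Theorems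

namespace WildMonic

open MvPowerSeries MonicDescent Literature.AlgebraicGeometry.Resolution

variable {k : Type} [Field k] (p : ℕ) [Fact p.Prime] [CharP k p] {d : ℕ}

/-! ## Valid flags against a clean representative -/

/-- **VALID FLAGS HAVE THE EXCEPTIONAL EXPONENTS OF THE CLEAN REPRESENTATIVE** (Per17 Prop. 7.4.5 (2) bookkeeping): if `shift d A g₀` is
`(1,0)`-clean when `0 ∈ E` and `(0,1)`-clean when `1 ∈ E`, and no re-centring annihilates the position, every valid `n = 0`, `h = 0` flag `g`
has `excExp = excExp(g₀)`. [cite: Perlega2020, Prop. 7.4.5 (2) proof (arXiv:2011.14443 chunk p0093)] -/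
theorem excExp_eq_of_isMMax_of_isWClean (E : Finset (Fin 2)) (A : Fin d → MvPowerSeries (Fin 2) k) {g₀ : MvPowerSeries (Fin 2) k}
    (hnz : ∀ g : MvPowerSeries (Fin 2) k, constantCoeff g = 0 → (newtonSet (shift d A g)).Nonempty)
    (hg₀ : constantCoeff g₀ = 0)
    (h10 : (0 : Fin 2) ∈ E → IsWClean p ![1, 0] (shift d A g₀)) (h01 : (1 : Fin 2) ∈ E → IsWClean p ![0, 1] (shift d A g₀))
    {g : MvPowerSeries (Fin 2) k} (hg : constantCoeff g = 0) (hval : IsMMax d A E g 0) :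
    excExp E (newtonSet (shift d A g)) = excExp E (newtonSet (shift d A g₀)) := by
  have hN0 := hnz g₀ hg₀
  have hN' := hnz g hg
  have hempty : newtonSet (0 : Fin d → MvPowerSeries (Fin 2) k) = ∅ := (newtonSet_eq_empty_iff _).2 fun _ => rfl
  have hne0 : shift d A g₀ ≠ 0 := fun h => by
    rw [h, hempty] at hN0
    exact Set.not_nonempty_empty hN0
  obtain ⟨-, h0g₀, h1g₀⟩ := wMin_eq_of_newtonSet_nonempty E (shift d A g₀) hN0
  obtain ⟨-, h0g, h1g⟩ := wMin_eq_of_newtonSet_nonempty E (shift d A g) hN'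
  have hr0 : excExp E (newtonSet (shift d A g)) 0 ≤ excExp E (newtonSet (shift d A g₀)) 0 := by
    by_cases h0 : (0 : Fin 2) ∈ E
    · have hle := wMin_shift_le_of_isWClean_shift p ![1, 0] A (h10 h0) (wMin_ne_top_of_ne_zero _ hne0) g
      rw [h0g h0, h0g₀ h0] at hle
      exact_mod_cast hle
    · rw [excExp_apply_zero, excExp_apply_zero, if_neg h0, if_neg h0]
  have hr1 : excExp E (newtonSet (shift d A g)) 1 ≤ excExp E (newtonSet (shift d A g₀)) 1 := by
    by_cases h1 : (1 : Fin 2) ∈ E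
    · have hle := wMin_shift_le_of_isWClean_shift p ![0, 1] A (h01 h1) (wMin_ne_top_of_ne_zero _ hne0) g
      rw [h1g h1, h1g₀ h1] at hle
      exact_mod_cast hle
    · rw [excExp_apply_one, excExp_apply_one, if_neg h1, if_neg h1]
  -- validity of `g`: `r₀(g₀) + r₁(g₀) ≤ r₀(g) + r₁(g)`
  have hv := hval g₀ hg₀
  rw [mOf_of_isN0 (Or.inr rfl), mOf_of_isN0 (Or.inr rfl), flagTuple_zero_shear, flagTuple_zero_shear] at hv
  ext i
  fin_cases i
  · exact le_antisymm hr0 (by simp only [Fin.zero_eta]; omega)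
  · exact le_antisymm hr1 (by simp only [Fin.mk_one]; omega)

/-- **VALID FLAGS HAVE `d ≤ d(clean representative)`**: if moreover `shift d A g₀` is `(1,1)`-clean, every valid `n = 0`, `h = 0` flag `g` has
`dRes ≤ dRes(g₀)` (`δ` is maximal at the `(1,1)`-clean representative, Prop. 5.1.3, and the exceptional exponents agree).
[cite: Perlega2020, Prop. 7.4.5 (2) (arXiv:2011.14443 chunk p0093)] -/
theorem dRes_le_of_isMMax_of_isWClean (E : Finset (Fin 2)) (A : Fin d → MvPowerSeries (Fin 2) k) {g₀ : MvPowerSeries (Fin 2) k}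
    (hnz : ∀ g : MvPowerSeries (Fin 2) k, constantCoeff g = 0 → (newtonSet (shift d A g)).Nonempty)
    (hg₀ : constantCoeff g₀ = 0) (h11 : IsWClean p ![1, 1] (shift d A g₀))
    (h10 : (0 : Fin 2) ∈ E → IsWClean p ![1, 0] (shift d A g₀)) (h01 : (1 : Fin 2) ∈ E → IsWClean p ![0, 1] (shift d A g₀))
    {g : MvPowerSeries (Fin 2) k} (hg : constantCoeff g = 0) (hval : IsMMax d A E g 0) :
    dRes E (newtonSet (shift d A g)) ≤ dRes E (newtonSet (shift d A g₀)) := by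
  have hr := excExp_eq_of_isMMax_of_isWClean p E A hnz hg₀ h10 h01 hg hval
  have hN0 := hnz g₀ hg₀
  have hN' := hnz g hg
  have hempty : newtonSet (0 : Fin d → MvPowerSeries (Fin 2) k) = ∅ := (newtonSet_eq_empty_iff _).2 fun _ => rfl
  have hne0 : shift d A g₀ ≠ 0 := fun h => by
    rw [h, hempty] at hN0
    exact Set.not_nonempty_empty hN0
  obtain ⟨a1, -, -⟩ := wMin_eq_of_newtonSet_nonempty E (shift d A g) hN'
  obtain ⟨b1, -, -⟩ := wMin_eq_of_newtonSet_nonempty E (shift d A g₀) hN0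
  have hle := wMin_shift_le_of_isWClean_shift p ![1, 1] A h11 (wMin_ne_top_of_ne_zero _ hne0) g
  rw [a1, b1, Nat.cast_le, hr] at hle
  omega

/-- **THE CLEAN REPRESENTATIVE HAS `d_𝓕 > 0` OFF THE EXITS** (Per17 Lemma 7.4.11 through res-L1-w43-stub-1's `exists_isMMax_dRes_pos`: some
valid flag has `d > 0`, and the clean representative dominates it). [cite: Perlega2020, Lemma 7.4.11 (arXiv:2011.14443 chunks p0094 L67, p0095 L1)] -/
theorem dRes_pos_of_isWClean [PerfectRing k p] (hd : 0 < d) {A : Fin d → MvPowerSeries (Fin 2) k} (hA : IsPos d A)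
    (hex : ¬ Exit₃ p d A) (E : Finset (Fin 2)) {g₀ : MvPowerSeries (Fin 2) k} (hg₀ : constantCoeff g₀ = 0)
    (h11 : IsWClean p ![1, 1] (shift d A g₀))
    (h10 : (0 : Fin 2) ∈ E → IsWClean p ![1, 0] (shift d A g₀)) (h01 : (1 : Fin 2) ∈ E → IsWClean p ![0, 1] (shift d A g₀)) :
    0 < dRes E (newtonSet (shift d A g₀)) := by
  obtain ⟨g, hg, hval, hpos⟩ := exists_isMMax_dRes_pos p hd hA hex E
  exact lt_of_lt_of_le hpos
    (dRes_le_of_isMMax_of_isWClean p E A (fun g' hg' => newtonSet_shift_nonempty_of_not_exit₃ hex hg') hg₀ h11 h10 h01 hg hval)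

/-! ## Point-set lemmas for the kept axis step -/

omit [Fact p.Prime] [CharP k p] in
/-- `δ(Ψ_L N) ≤ 2·δ(N)`: the point of `N` realising `δ` goes to a point of total degree `(δ − L) + P₁ ≤ 2δ`. -/
theorem deltaL_image_psi_le_two_mul {N : Set (Fin 2 →₀ ℕ)} (hN : N.Nonempty) (L : ℕ) :
    deltaL (psi L '' N) ≤ 2 * deltaL N := by
  obtain ⟨P, hP, hPd⟩ := exists_eq_deltaL hN
  have h := deltaL_le (N := psi L '' N) ⟨P, hP, rfl⟩
  rw [psi_apply_zero, psi_apply_one] at h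
  omega

omit [Fact p.Prime] [CharP k p] in
/-- **THE TRANSPORTED CORNER OF A KEPT AXIS STEP** (Per17 Lemma 9.1.2: `d′ = d ⇒ y^d ∈ in(I₂′)`): if `dRes` is kept by the monomial point step in
the `x₁`-chart (scale `L ≤` all degrees), the successor set `Ψ_L N` contains a point `P′` with `P′₀ = r′₀` and `P′₀ + P′₁ = δ(Ψ_L N)` — the image
of the parent's corner `(0, d)` of the reduced set. [cite: Perlega2020, Lemma 9.1.2 proof (arXiv:2011.14443 p0104)] -/
theorem exists_corner_of_kept (E : Finset (Fin 2)) {N : Set (Fin 2 →₀ ℕ)} {L : ℕ} (hN : N.Nonempty) (hL : ∀ P ∈ N, L ≤ P 0 + P 1)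
    (hkeep : dRes (excNext E) (psi L '' N) = dRes E N) :
    ∃ P' ∈ psi L '' N, P' 0 = excExp (excNext E) (psi L '' N) 0 ∧ P' 0 + P' 1 = deltaL (psi L '' N) := by
  have hred := reduce_excNext_image_psi E hN hL
  have hkeep' : deltaL (psi (dRes E N) '' reduce (excExp E N) N) = deltaL (reduce (excExp E N) N) := by
    have h := hkeep
    unfold dRes at h ⊢
    rwa [hred] at h
  obtain ⟨Q, hQ, hQδ⟩ := exists_eq_deltaL (reduce_nonempty (excExp E N) hN)
  obtain ⟨hQ0, hQ1⟩ := eq_corner_of_deltaL_image_psi_eq hkeep' hQ hQδ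
  -- `Ψ_δ Q` is a reduced point of the successor set: `Ψ_δ Q = P′ − r′` for some `P′ ∈ Ψ_L N`
  have hmem : psi (dRes E N) Q ∈ reduce (excExp (excNext E) (psi L '' N)) (psi L '' N) := by
    rw [hred]; exact ⟨Q, hQ, rfl⟩
  obtain ⟨P', hP', hP'Q⟩ := hmem
  have hr0 := excExp_le (E := excNext E) hP' 0
  have hr1 := excExp_le (E := excNext E) hP' 1
  have h0 : P' 0 - excExp (excNext E) (psi L '' N) 0 = 0 := by
    have h := congrArg (fun R : Fin 2 →₀ ℕ => R 0) hP'Q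
    simp only [Finsupp.tsub_apply, psi_apply_zero] at h
    rw [h, hQ0, zero_add, show dRes E N = deltaL (reduce (excExp E N) N) from rfl, hQ1, Nat.sub_self]
  have h1 : P' 1 - excExp (excNext E) (psi L '' N) 1 = dRes E N := by
    have h := congrArg (fun R : Fin 2 →₀ ℕ => R 1) hP'Q
    simp only [Finsupp.tsub_apply, psi_apply_one] at h
    rw [h, hQ1]
    rfl
  have hsum := dRes_add_excExp (excNext E) (hN.image (psi L))
  refine ⟨P', hP', by omega, ?_⟩
  rw [← hsum, hkeep]
  omega

omit [Fact p.Prime] [CharP k p] in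
/-- The source weight of the perturbed weight `ρ_M = (M+1, M)` is `(M+1, 2M+1)`. -/
theorem srcWeight_rhoWeight (M : ℕ) : srcWeight (fun i : Fin 2 => if i = 0 then M + 1 else M) = ![M + 1, 2 * M + 1] := by
  funext i
  fin_cases i
  · simp [srcWeight]
  · simp [srcWeight]; ring

/-! ## The `s = ⊤` variant of the re-cleaning inside a maximal setting class -/

section Top

variable [PerfectRing k p] (E : Finset (Fin 2))

/-- **SIMULTANEOUS CLEANNESS INSIDE A MAXIMAL SETTING CLASS KEEPS `sFlag = ⊤`**: stub-7's `exists_shift_isWClean_list_of_upper` with its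
`s`-clause quantified over every natural `s` at once — the cleaning process does not depend on `s`, so if every `s` lies below `sFlag` before,
every `s` lies below it after. [cite: Perlega2020, Lemma 5.2.2 (1) with Prop. 5.1.5 (arXiv:2011.14443 Ch. 5)] -/
theorem exists_shift_isWClean_list_of_upper_top (hd : 0 < d) :
    ∀ (ws : List (Fin 2 → ℕ)), (∀ w ∈ ws, 0 < w 0 + w 1) →
      ∀ (B : Fin d → MvPowerSeries (Fin 2) k), (∀ j, constantCoeff (B j) = 0) → wMin ![1, 1] B ≠ ⊤ →
      (∀ g : MvPowerSeries (Fin 2) k, constantCoeff g = 0 → wMin ![1, 1] (shift d B g) ≤ wMin ![1, 1] B) →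
      ((0 : Fin 2) ∈ E → ∀ g : MvPowerSeries (Fin 2) k, constantCoeff g = 0 → wMin ![1, 0] (shift d B g) ≤ wMin ![1, 0] B) →
      ((1 : Fin 2) ∈ E → ∀ g : MvPowerSeries (Fin 2) k, constantCoeff g = 0 → wMin ![0, 1] (shift d B g) ≤ wMin ![0, 1] B) →
      sFlag E (newtonSet B) = ⊤ →
      ∃ g : MvPowerSeries (Fin 2) k, constantCoeff g = 0 ∧ (∀ w ∈ ws, IsWClean p w (shift d B g)) ∧
        (∀ w' : Fin 2 → ℕ, wMin w' B ≤ wMin w' (shift d B g)) ∧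
        excExp E (newtonSet (shift d B g)) = excExp E (newtonSet B) ∧ dRes E (newtonSet (shift d B g)) = dRes E (newtonSet B) ∧
        sFlag E (newtonSet (shift d B g)) = ⊤ := by
  intro ws
  induction ws with
  | nil =>
    intro _ B hB hfin hub11 hub10 hub01 hs
    exact ⟨0, map_zero _, fun w hw => by simp at hw, fun w' => by rw [shift_zero], by rw [shift_zero], by rw [shift_zero],
      by rw [shift_zero]; exact hs⟩
  | cons ν ws ih =>
    intro hws0 B hB hfin hub11 hub10 hub01 hs
    obtain ⟨g₁, hg₁0, hws, hmono₁, hr₁, hδ₁, hs₁⟩ :=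
      ih (fun w hw => hws0 w (List.mem_cons_of_mem _ hw)) B hB hfin hub11 hub10 hub01 hs
    have hB₁ : ∀ j, constantCoeff (shift d B g₁ j) = 0 := constantCoeff_shift B hB hg₁0
    have h11eq : wMin ![1, 1] (shift d B g₁) = wMin ![1, 1] B := le_antisymm (hub11 _ hg₁0) (hmono₁ _)
    have hfin₁ : wMin ![1, 1] (shift d B g₁) ≠ ⊤ := by rw [h11eq]; exact hfin
    have hub11₁ : ∀ g : MvPowerSeries (Fin 2) k, constantCoeff g = 0 →
        wMin ![1, 1] (shift d (shift d B g₁) g) ≤ wMin ![1, 1] (shift d B g₁) := fun g hg => by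
      rw [shift_shift, h11eq]; exact hub11 _ (by rw [map_add, hg, hg₁0, add_zero])
    have hub10₁ : (0 : Fin 2) ∈ E → ∀ g : MvPowerSeries (Fin 2) k, constantCoeff g = 0 →
        wMin ![1, 0] (shift d (shift d B g₁) g) ≤ wMin ![1, 0] (shift d B g₁) := fun h0 g hg => by
      rw [shift_shift]
      exact (hub10 h0 _ (by rw [map_add, hg, hg₁0, add_zero])).trans (hmono₁ _)
    have hub01₁ : (1 : Fin 2) ∈ E → ∀ g : MvPowerSeries (Fin 2) k, constantCoeff g = 0 →
        wMin ![0, 1] (shift d (shift d B g₁) g) ≤ wMin ![0, 1] (shift d B g₁) := fun h1 g hg => by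
      rw [shift_shift]
      exact (hub01 h1 _ (by rw [map_add, hg, hg₁0, add_zero])).trans (hmono₁ _)
    have hν : 0 < ν 0 + ν 1 := hws0 ν (by simp)
    obtain ⟨n, hνn, hfinn⟩ := exists_cleanSeqS_stop_of_upper p ν (shift d B g₁) hd hB₁ hfin₁ hub11₁ hν
    -- the setting is kept and EVERY natural `s` stays below `sFlag`
    have hset : ∀ s : ℕ, excExp E (newtonSet (cleanSeqS p ν hd (shift d B g₁) n).1) = excExp E (newtonSet (shift d B g₁)) ∧
        dRes E (newtonSet (cleanSeqS p ν hd (shift d B g₁) n).1) = dRes E (newtonSet (shift d B g₁)) ∧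
        (s : ℕ∞) ≤ sFlag E (newtonSet (cleanSeqS p ν hd (shift d B g₁) n).1) := fun s =>
      cleanSeqS_setting_of_upper p ν (shift d B g₁) hd hB₁ hub11₁ E hub10₁ hub01₁ (s := s) (by rw [hs₁]; exact le_top) n
    obtain ⟨hrn, hδn, -⟩ := hset 0
    have hsn : sFlag E (newtonSet (cleanSeqS p ν hd (shift d B g₁) n).1) = ⊤ :=
      eq_top_iff.mpr (ENat.forall_natCast_le_iff_le.mp fun s _ => (hset s).2.2)
    have hspec := cleanSeqS_spec p ν (shift d B g₁) hd n
    have hB₁ne : shift d B g₁ ≠ 0 := fun h0 => by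
      apply hfin₁
      rw [h0]
      unfold wMin slotWOrd
      simp only [Pi.zero_apply, weightedOrder_zero]
      rw [iInf_eq_top]
      intro i
      exact ENat.mul_top (by exact_mod_cast (slotWeight_pos i).ne')
    refine ⟨(cleanSeqS p ν hd (shift d B g₁) n).2 + g₁, by rw [map_add, hspec.2, hg₁0, add_zero], ?_, ?_, ?_, ?_, ?_⟩
    · intro w hw
      rw [← shift_shift, ← hspec.1]
      rcases List.mem_cons.1 hw with rfl | hmem
      · exact hνn
      · exact (cleanSeqS_preserve p ν (shift d B g₁) hd hB₁ w (hws w hmem) (wMin_ne_top_of_ne_zero w hB₁ne) n).1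
    · intro w'
      rw [← shift_shift, ← hspec.1]
      exact (hmono₁ w').trans (wMin_le_cleanSeqS_all p ν (shift d B g₁) hd hB₁ w' n)
    · rw [← shift_shift, ← hspec.1, hrn, hr₁]
    · rw [← shift_shift, ← hspec.1, hδn, hδ₁]
    · rw [← shift_shift, ← hspec.1]; exact hsn

/-- **THE CLEAN REPRESENTATIVE WITH `s = ⊤` OR WITH FINITE MAXIMAL `s`** (Per17 Prop. 7.4.5 (3) + Lemma 7.4.11 bookkeeping): from a
representative `shift d A g₀` clean for every weight of a list `ws ∋ (1,1)` (`∋ (1,0)` if `0 ∈ E`, `∋ (0,1)` if `1 ∈ E`), with `δ > 0`, at a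
position none of whose re-centrings is annihilated: some member of its setting class is clean for every weight of `ws` AND either has
`sFlag = ⊤`, or is SECONDARY CLEAN with finite `s` MAXIMAL over the class (stub-7's `exists_sMax_clean_rep`, its `⊤` branch re-cleaned by
`exists_shift_isWClean_list_of_upper_top`). [cite: Perlega2020, Prop. 7.4.5 (3), Lemma 7.4.11 (arXiv:2011.14443 chunks p0093–p0095)] -/
theorem exists_isWClean_list_sTop_or_sMax (hd : 0 < d) (A : Fin d → MvPowerSeries (Fin 2) k) (hA : ∀ j, constantCoeff (A j) = 0)
    (hnz : ∀ g : MvPowerSeries (Fin 2) k, constantCoeff g = 0 → (newtonSet (shift d A g)).Nonempty)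
    (ws : List (Fin 2 → ℕ)) (hws0 : ∀ w ∈ ws, 0 < w 0 + w 1) (h11 : (![1, 1] : Fin 2 → ℕ) ∈ ws)
    (h10 : (0 : Fin 2) ∈ E → (![1, 0] : Fin 2 → ℕ) ∈ ws) (h01 : (1 : Fin 2) ∈ E → (![0, 1] : Fin 2 → ℕ) ∈ ws)
    {g₀ : MvPowerSeries (Fin 2) k} (hg₀ : constantCoeff g₀ = 0) (hclean₀ : ∀ w ∈ ws, IsWClean p w (shift d A g₀))
    (hδ₀ : 0 < dRes E (newtonSet (shift d A g₀))) :
    ∃ g : MvPowerSeries (Fin 2) k, constantCoeff g = 0 ∧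
      excExp E (newtonSet (shift d A g)) = excExp E (newtonSet (shift d A g₀)) ∧
      dRes E (newtonSet (shift d A g)) = dRes E (newtonSet (shift d A g₀)) ∧
      (∀ w ∈ ws, IsWClean p w (shift d A g)) ∧
      (sFlag E (newtonSet (shift d A g)) = ⊤ ∨
        ∃ s : ℕ, IsSClean p E (shift d A g) ∧ sFlag E (newtonSet (shift d A g)) = s ∧
          ∀ g' : MvPowerSeries (Fin 2) k, constantCoeff g' = 0 →
            excExp E (newtonSet (shift d A g')) = excExp E (newtonSet (shift d A g₀)) →
            dRes E (newtonSet (shift d A g')) = dRes E (newtonSet (shift d A g₀)) → sFlag E (newtonSet (shift d A g')) ≤ s) := by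
  rcases exists_sMax_clean_rep p hd E A hA hnz ws hws0 h11 h10 h01 hg₀ hclean₀ hδ₀ with ⟨g, hg, hr, hδ, htop⟩ |
    ⟨g, s, hg, hr, hδ, hws, hsc, hs, hmax⟩
  · -- the `⊤` member: re-clean it for the list inside the class, keeping `sFlag = ⊤`
    have hempty : newtonSet (0 : Fin d → MvPowerSeries (Fin 2) k) = ∅ := (newtonSet_eq_empty_iff _).2 fun _ => rfl
    have hne0 : shift d A g₀ ≠ 0 := fun h => by
      have hN := hnz g₀ hg₀
      rw [h, hempty] at hN
      exact Set.not_nonempty_empty hN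
    have hneg : shift d A g ≠ 0 := fun h => by
      have hN := hnz g hg
      rw [h, hempty] at hN
      exact Set.not_nonempty_empty hN
    -- the three setting weights are maximal at `g₀`, and `g` has the same three
    have hub11 : ∀ g' : MvPowerSeries (Fin 2) k, constantCoeff g' = 0 → wMin ![1, 1] (shift d A g') ≤ wMin ![1, 1] (shift d A g₀) :=
      fun g' _ => wMin_shift_le_of_isWClean_shift p _ A (hclean₀ _ h11) (wMin_ne_top_of_ne_zero _ hne0) g'
    have hub10 : (0 : Fin 2) ∈ E → ∀ g' : MvPowerSeries (Fin 2) k, constantCoeff g' = 0 →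
        wMin ![1, 0] (shift d A g') ≤ wMin ![1, 0] (shift d A g₀) :=
      fun h0 g' _ => wMin_shift_le_of_isWClean_shift p _ A (hclean₀ _ (h10 h0)) (wMin_ne_top_of_ne_zero _ hne0) g'
    have hub01 : (1 : Fin 2) ∈ E → ∀ g' : MvPowerSeries (Fin 2) k, constantCoeff g' = 0 →
        wMin ![0, 1] (shift d A g') ≤ wMin ![0, 1] (shift d A g₀) :=
      fun h1 g' _ => wMin_shift_le_of_isWClean_shift p _ A (hclean₀ _ (h01 h1)) (wMin_ne_top_of_ne_zero _ hne0) g'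
    obtain ⟨a1, a2, a3⟩ := wMin_eq_of_newtonSet_nonempty E (shift d A g) (hnz g hg)
    obtain ⟨b1, b2, b3⟩ := wMin_eq_of_newtonSet_nonempty E (shift d A g₀) (hnz g₀ hg₀)
    have h11g : wMin ![1, 1] (shift d A g) = wMin ![1, 1] (shift d A g₀) := by rw [a1, b1, hδ, hr]
    have h10g : (0 : Fin 2) ∈ E → wMin ![1, 0] (shift d A g) = wMin ![1, 0] (shift d A g₀) := fun h0 => by rw [a2 h0, b2 h0, hr]
    have h01g : (1 : Fin 2) ∈ E → wMin ![0, 1] (shift d A g) = wMin ![0, 1] (shift d A g₀) := fun h1 => by rw [a3 h1, b3 h1, hr]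
    have hBg : ∀ j, constantCoeff (shift d A g j) = 0 := constantCoeff_shift A hA hg
    obtain ⟨g₂, hg₂0, hws₂, -, hr₂, hδ₂, hs₂⟩ := exists_shift_isWClean_list_of_upper_top p E hd ws hws0 (shift d A g) hBg
      (wMin_ne_top_of_ne_zero _ hneg)
      (fun g' hg' => by rw [shift_shift, h11g]; exact hub11 _ (by rw [map_add, hg', hg, add_zero]))
      (fun h0 g' hg' => by rw [shift_shift, h10g h0]; exact hub10 h0 _ (by rw [map_add, hg', hg, add_zero]))
      (fun h1 g' hg' => by rw [shift_shift, h01g h1]; exact hub01 h1 _ (by rw [map_add, hg', hg, add_zero]))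
      htop
    rw [shift_shift] at hws₂ hr₂ hδ₂ hs₂
    exact ⟨g₂ + g, by rw [map_add, hg₂0, hg, add_zero], hr₂.trans hr, hδ₂.trans hδ, hws₂, Or.inl hs₂⟩
  · exact ⟨g, hg, hr, hδ, hws, Or.inr ⟨s, hsc, hs, hmax⟩⟩

end Top

end WildMonic

end Summit.ResolutionOfSingularities.ResolutionOfSingularities.Theorems

end
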